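import Summits.ValiantsHypothesis.ValiantsHypothesis.Theorems.GrenetZeonDualUnipotentThreeHalvesLongMassLedgerTorusSlow

/-!
# PART VII — THE LEDGER / `RelCert` CURRENCY (★ `relCert_iff_coordinate_span`, ★ `not_relCert_of_count`, `relCert_curve_zero_of_algebraic_family`) — Theorems-side port of val-idea-28 g5's staged `…LongMassLedgerTorus.lean` (sha16 98392e2975984a00, 1360 l., 84 decls;
# itself the verbatim Part I/II-basics/III/IV/V/VI/VII extract of the crux workfile `Cruxes/DualUnipotentThreeHalves/InitialForm.lean` rev 14;
# crit-7 g3 V40 δ-READ ✓ of rev 13, STAGE REQUEST; desk val-lit RULINGS #389/#391/#392 «LedgerTorus claim protocol»; hand val-port-3 g3 «CLAIM LedgerTorus» 00:52Z)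

PORT NOTE.  Decl texts VERBATIM BY NAME; namespaces as staged (`…Theorems.GrenetZeon.InitialForm.*`); the ONLY changes are one-line docstrings on helper lemmas the gate's `lint.docstring` requires (marked «docstring added in the port»), the 400-line-cap SPLIT into five
chained modules `GrenetZeonDualUnipotentThreeHalvesLongMassLedgerTorus{Initial, Curve, SlowCurve, Slow, ∅}.lean` (this file imports `GrenetZeonDualUnipotentThreeHalvesLongMassLedgerTorusSlow`) and these headers; `--supports stmt-ValiantsHypothesis-24318`
helper.  ALL CREDIT: val-idea-28 g5 (lens «degeneration – orbit-closure»).  HONEST STATUS (author's, verbatim in spirit): an INSTRUMENT — the normal form of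
(c)-certificates under a torus symmetry; proves NO case of (c) `SlowCore.LongMassSlowLawInv`, is NOT progress on (c); crux 24318 OPEN; VP ≠ VNP is NOT proved.
The author's full module docstring is reproduced in `GrenetZeonDualUnipotentThreeHalvesLongMassLedgerTorusInitial.lean`.
-/

set_option linter.dupNamespace false

noncomputable section

/-! # PART VII — THE LEDGER / `RelCert` CURRENCY OF (c) `LongMassSlowLawInv` (rev 10)

The ONE research stub of the line of record (`Lines/slow_core.lean` rev 3) is (c-Inv) `SlowCore.LongMassSlowLawInv`: every `IrreducibleInv`
nilpotent affine pencil has a `RelCert` of price `≤ c·√n·b`, where `RelCert n m N P := ∃ K k, Ledger n m N ⊤ K k ∧ n·k + (n² − finrank K) ≤ P`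
and `Ledger` bounds the `s`-degree of EVERY power `b ≤ n − 1` (window currency).  Same shape as `Slow`, so Parts I/IV/VI transfer verbatim with a
power parameter: `Gp` / `eval_Gp` (universal coefficients of the `p`-th power), `ledgerCone_torusAct`, `ledger_graded_of_torusEquivariant`,
★ `relCert_iff_coordinate_span` (distinct weights: `RelCert N P` iff some coordinate set `T` with `n·k + (n² − #T) ≤ P` spans a subspace inside the
window cone) and the census ★ `not_relCert_of_count` — BY NAME against `Theorems…SlowCoreLedger`.  USE (closure lever (C1)–(C3) in (c)'s
currency): a torus-equivariant candidate enemy of (c) is priced by a per-coordinate window-degree census.  Nothing here bears on the truth of (c). -/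

namespace Summit.ValiantsHypothesis.ValiantsHypothesis.Theorems.GrenetZeon.InitialForm.LedgerTorus

open scoped Polynomial
open Summit.ValiantsHypothesis.ValiantsHypothesis.Cruxes.TwoDimCoefficients.DimTwoCases (AffMat IsAffine)
open Summit.ValiantsHypothesis.ValiantsHypothesis.Theorems.GrenetZeon.RadicalSplit (lineSubst)
open Summit.ValiantsHypothesis.ValiantsHypothesis.Theorems.GrenetZeon.InitialForm.TorusClosure (TorusEquivariant
  torusAct_inv_cancel)
open Summit.ValiantsHypothesis.ValiantsHypothesis.Theorems.GrenetZeon.InitialForm.SlowCurve (curve univCurve univCurve_map φ φ_apply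
  totalDegree_le_iff_coeff)
open Summit.ValiantsHypothesis.ValiantsHypothesis.Theorems.GrenetZeon.InitialForm.SlowTorus (map_lineSubst_torusAct conj_pow
  totalDegree_conj_le curve_const_zero finrank_span_single)
open Summit.ValiantsHypothesis.ValiantsHypothesis.Theorems.GrenetZeon.SlowCore (Ledger RelCert)

variable {n m : ℕ}

/-- Universal `s^e`-coefficient of an entry of the `p`-th power along the universal line (Part V's `G` is `p = n − 1`). -/
def Gp (d : ℕ) (F : ℕ → AffMat n m) (x : Fin n × Fin n → ℂ) (p e : ℕ) (a b : Fin m) : MvPolynomial (Fin n × Fin n) ℂ[X] :=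
  MvPolynomial.coeff (Finsupp.single 0 e) (((univCurve d F x) ^ p) a b)

/-- `eval_Gp` — helper of this port (see the module docstring for its role). (docstring added in the port) -/
theorem eval_Gp (d : ℕ) (F : ℕ → AffMat n m) (x : Fin n × Fin n → ℂ) (p e : ℕ) (a b : Fin m) (t : ℂ) (v : Fin n × Fin n → ℂ) :
    MvPolynomial.eval v (MvPolynomial.map (Polynomial.evalRingHom t) (Gp d F x p e a b))
      = MvPolynomial.coeff (Finsupp.single 0 e) ((((curve d F t).map (lineSubst x v)) ^ p) a b) := by
  rw [← φ_apply, Gp, ← MvPolynomial.coeff_map, ← univCurve_map, ← Matrix.map_pow, Matrix.map_apply]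

/-- The WINDOW cone: every power `b ≤ n − 1` along every line has `s`-degree `≤ k` (the body of `Ledger ⊤ · k` for one direction). -/
def WindowCone (N : AffMat n m) (k : ℕ) (v : Fin n × Fin n → ℂ) : Prop :=
  ∀ x : Fin n × Fin n → ℂ, ∀ b : ℕ, b ≤ n - 1 → ∀ i j : Fin m, ((((N.map (lineSubst x v)) ^ b) i j)).totalDegree ≤ k

/-- `ledger_top_iff_windowCone` — helper of this port (see the module docstring for its role). (docstring added in the port) -/
theorem ledger_top_iff_windowCone (N : AffMat n m) (K : Submodule ℂ (Fin n × Fin n → ℂ)) (k : ℕ) :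
    Ledger n m N (fun _ => True) K k ↔ ∀ v ∈ K, WindowCone N k v :=
  ⟨fun h v hv x b hb i j => h x v hv b hb i j trivial trivial, fun h x v hv b hb i j _ _ => h v hv x b hb i j⟩

/-- ★ The window cone of a torus-equivariant pencil is torus-stable. -/
theorem windowCone_torusAct (N : AffMat n m) {w : Fin n × Fin n → ℕ} (hT : TorusEquivariant N w) {k : ℕ}
    {v : Fin n × Fin n → ℂ} (hv : WindowCone N k v) {τ : ℂ} (hτ : τ ≠ 0) : WindowCone N k (torusAct w τ v) := by
  intro x b hb i j
  obtain ⟨c, D, D', hc, -, hD'D, hconj⟩ := hT τ hτ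
  set x' := torusAct w τ⁻¹ x with hx'
  have hx : x = torusAct w τ x' := (torusAct_inv_cancel w hτ x).symm
  rw [hx, map_lineSubst_torusAct N hconj x' v, smul_pow]
  have hE'E : D'.map (MvPolynomial.C : ℂ → MvPolynomial (Fin 1) ℂ) * D.map MvPolynomial.C = 1 := by
    rw [← Matrix.map_mul, hD'D, Matrix.map_one MvPolynomial.C (map_zero _) (map_one _)]
  rcases conj_pow (D.map MvPolynomial.C) (D'.map MvPolynomial.C) (N.map (lineSubst x' v)) hE'E b with h | h
  · rw [h]
    exact totalDegree_conj_le D D' (c ^ b) _ (fun i j => hv x' b hb i j) i j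
  · rw [h, pow_zero, pow_zero, one_smul, Matrix.one_apply]
    split_ifs <;> simp

/-- The polynomial family cutting out the window cone. -/
def windowFamily (N : AffMat n m) (k : ℕ) : Set (MvPolynomial (Fin n × Fin n) ℂ) :=
  {H | ∃ (x : Fin n × Fin n → ℂ) (p e : ℕ) (a b : Fin m), p ≤ n - 1 ∧ k < e ∧
    H = MvPolynomial.map (Polynomial.evalRingHom 0) (Gp 0 (fun _ => N) x p e a b)}

/-- `windowCone_iff_family` — helper of this port (see the module docstring for its role). (docstring added in the port) -/
theorem windowCone_iff_family (N : AffMat n m) (k : ℕ) (v : Fin n × Fin n → ℂ) :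
    WindowCone N k v ↔ ∀ H ∈ windowFamily N k, MvPolynomial.eval v H = 0 := by
  constructor
  · rintro h H ⟨x, p, e, a, b, hp, he, rfl⟩
    rw [eval_Gp, curve_const_zero]
    exact (totalDegree_le_iff_coeff _ k).mp (h x p hp a b) e he
  · intro h x p hp a b
    rw [totalDegree_le_iff_coeff]
    intro e he
    have := h _ ⟨x, p, e, a, b, hp, he, rfl⟩
    rwa [eval_Gp, curve_const_zero] at this

/-- ★ **H_coord IN THE LEDGER CURRENCY.**  A whole-pencil ledger `(K, k)` of a torus-equivariant affine pencil may be taken WEIGHT-GRADED, same `k`,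
same finrank (hence same PRICE). -/
theorem ledger_graded_of_torusEquivariant (N : AffMat n m) (w : Fin n × Fin n → ℕ) (hT : TorusEquivariant N w)
    (K : Submodule ℂ (Fin n × Fin n → ℂ)) (k : ℕ) (hK : Ledger n m N (fun _ => True) K k) :
    ∃ K₀ : Submodule ℂ (Fin n × Fin n → ℂ), Module.finrank ℂ K₀ = Module.finrank ℂ K ∧
      (∀ s ∈ K₀, ∀ c, wtProj w c s ∈ K₀) ∧ Ledger n m N (fun _ => True) K₀ k := by
  rw [ledger_top_iff_windowCone] at hK
  have hstab : ∀ τ : ℂ, τ ≠ 0 → ∀ v ∈ K, ∀ H ∈ windowFamily N k, MvPolynomial.eval (torusAct w τ v) H = 0 := by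
    intro τ hτ v hv
    rw [← windowCone_iff_family]
    exact windowCone_torusAct N hT (hK v hv) hτ
  obtain ⟨K₀, hdim, hgr, hZ⟩ := exists_graded_of_torusStable w K (windowFamily N k) hstab
  refine ⟨K₀, hdim, hgr, ?_⟩
  rw [ledger_top_iff_windowCone]
  exact fun v hv => (windowCone_iff_family N k v).mpr (hZ v hv)

/-- ★ **EXACT CHARACTERISATION OF `RelCert` (by name), distinct coordinate weights.**  `RelCert n m N P` iff some coordinate SET `T` with
`n·k + (n² − #T) ≤ P` spans a subspace on which the whole-pencil ledger of order `k` holds. -/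
theorem relCert_iff_coordinate_span (N : AffMat n m) (w : Fin n × Fin n → ℕ) (hT : TorusEquivariant N w) (hw : Function.Injective w)
    (P : ℕ) :
    RelCert n m N P ↔ ∃ (k : ℕ) (T : Finset (Fin n × Fin n)), n * k + (n * n - T.card) ≤ P ∧
      Ledger n m N (fun _ => True)
        (Submodule.span ℂ (Set.range fun e : T => (Pi.single (e : Fin n × Fin n) (1 : ℂ) : Fin n × Fin n → ℂ))) k := by
  classical
  constructor
  · rintro ⟨K, k, hK, hprice⟩
    obtain ⟨K₀, hdim₀, hgr, hK₀⟩ := ledger_graded_of_torusEquivariant N w hT K k hK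
    set T : Finset (Fin n × Fin n) := Finset.univ.filter fun e => (Pi.single e (1 : ℂ) : Fin n × Fin n → ℂ) ∈ K₀ with hTdef
    set Sp := Submodule.span ℂ (Set.range fun e : T => (Pi.single (e : Fin n × Fin n) (1 : ℂ) : Fin n × Fin n → ℂ)) with hSp
    have hZ : ∀ e, e ∉ (∅ : Finset (Fin n × Fin n)) → ∀ e', w e' = w e → e' = e := fun e _ e' h => hw h
    have hle : K₀ ≤ Sp := by
      intro s hs
      have hsum : s = ∑ e, s e • (Pi.single e (1 : ℂ) : Fin n × Fin n → ℂ) := by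
        conv_lhs => rw [← Finset.univ_sum_single s]
        refine Finset.sum_congr rfl fun e _ => ?_
        funext e'
        by_cases h : e' = e
        · subst h; simp
        · simp [h]
      rw [hsum]
      refine Submodule.sum_mem _ fun e _ => ?_
      by_cases hse : s e = 0
      · rw [hse, zero_smul]; exact Submodule.zero_mem _
      · have hmem : (Pi.single e (1 : ℂ) : Fin n × Fin n → ℂ) ∈ K₀ := by
          have h1 := hgr s hs (w e)
          rw [wtProj_eq_single w ∅ hZ (Finset.notMem_empty e) s] at h1
          have h2 := K₀.smul_mem (s e)⁻¹ h1
          rwa [smul_smul, inv_mul_cancel₀ hse, one_smul] at h2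
        have heT : e ∈ T := by rw [hTdef, Finset.mem_filter]; exact ⟨Finset.mem_univ _, hmem⟩
        exact Submodule.smul_mem _ _ (Submodule.subset_span ⟨⟨e, heT⟩, rfl⟩)
    have hge : Sp ≤ K₀ := by
      rw [hSp, Submodule.span_le]
      rintro _ ⟨⟨e, he⟩, rfl⟩
      rw [hTdef, Finset.mem_filter] at he
      exact he.2
    have heq : Sp = K₀ := le_antisymm hge hle
    refine ⟨k, T, ?_, ?_⟩
    · have h1 : Module.finrank ℂ Sp = T.card := by rw [hSp, finrank_span_single]
      rw [heq, hdim₀] at h1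
      rw [← h1]; exact hprice
    · exact (ledger_top_iff_windowCone _ _ _).mpr fun v hv => (ledger_top_iff_windowCone _ _ _).mp hK₀ v (hge hv)
  · rintro ⟨k, T, hprice, hL⟩
    exact ⟨_, k, hL, by rw [finrank_span_single]; exact hprice⟩

/-- ★ **CENSUS KILL IN (c)'s CURRENCY.**  For a torus-equivariant affine pencil with distinct coordinate weights: if for every order `k` the price
computed from the NUMBER of coordinates `e` whose coordinate direction `δ_e` lies in the window cone of order `k` already exceeds `P`, then
`¬ RelCert n m N P`.  (The coordinate set `T` of `relCert_iff_coordinate_span` consists of such `e`.) -/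
theorem not_relCert_of_count (N : AffMat n m) (w : Fin n × Fin n → ℕ) (hT : TorusEquivariant N w) (hw : Function.Injective w) (P : ℕ)
    (hcount : ∀ k : ℕ,
      P < n * k + (n * n - (open Classical in (Finset.univ.filter fun e : Fin n × Fin n =>
        WindowCone N k (Pi.single e (1 : ℂ))).card))) :
    ¬ RelCert n m N P := by
  classical
  rw [relCert_iff_coordinate_span N w hT hw P]
  rintro ⟨k, T, hprice, hL⟩
  rw [ledger_top_iff_windowCone] at hL
  have hsub : T ⊆ Finset.univ.filter fun e : Fin n × Fin n => WindowCone N k (Pi.single e (1 : ℂ)) := by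
    intro e he
    rw [Finset.mem_filter]
    exact ⟨Finset.mem_univ _, hL _ (Submodule.subset_span ⟨⟨e, he⟩, rfl⟩)⟩
  have hcard := Finset.card_le_card hsub
  have := hcount k
  omega


/-- ★ **`RelCert` ALONG POLYNOMIAL CURVES — ALGEBRAIC LEDGER FAMILIES** (Part V in (c)'s currency).  Along `curve d F`, an ALGEBRAIC family
`N ≤ (ι → ℂ[X])` of directions whose evaluations satisfy the whole-pencil window condition of order `k` for all `t` off a finite set passes to
`t = 0` with the same `k` and the generic rank, hence with the same PRICE: `RelCert n m (curve d F 0) P` whenever `n·k + (n² − rank N) ≤ P`.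
(Kernel half of «RelCert-holders are closed» through ONE canonical move; the pointwise statement needs curve selection.) -/
theorem relCert_curve_zero_of_algebraic_family (d : ℕ) (F : ℕ → AffMat n m) (k P : ℕ)
    (N : Submodule ℂ[X] (Fin n × Fin n → ℂ[X])) (S : Finset ℂ)
    (hcert : ∀ t : ℂ, t ∉ S → ∀ p ∈ N, WindowCone (curve d F t) k (CurveClosure.ev t p))
    (hprice : n * k + (n * n - Module.finrank ℂ[X] N) ≤ P) :
    RelCert n m (curve d F 0) P := by
  classical
  set T : Set ℂ := (↑(insert (0 : ℂ) S) : Set ℂ)ᶜ with hT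
  have hTinf : T.Infinite := (Finset.finite_toSet _).infinite_compl
  have hT0 : (0 : ℂ) ∉ T := by simp [hT]
  set 𝓕 : Set (MvPolynomial (Fin n × Fin n) ℂ[X]) :=
    {H | ∃ x p e a b, p ≤ n - 1 ∧ k < e ∧ H = Gp d F x p e a b} with h𝓕
  have hS : ∀ t ∈ T, ∀ q ∈ N, ∀ H ∈ 𝓕,
      MvPolynomial.eval (CurveClosure.ev t q) (MvPolynomial.map (Polynomial.evalRingHom t) H) = 0 := by
    intro t ht q hq H hH
    obtain ⟨x, p, e, a, b, hp, he, rfl⟩ := hH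
    have htS : t ∉ S := fun h => ht (by simp [h])
    rw [eval_Gp]
    exact (totalDegree_le_iff_coeff _ k).mp (hcert t htS q hq x p hp a b) e he
  obtain ⟨K₀, hK₀dim, -, hK₀⟩ := CurveClosure.exists_limit_of_algebraic_family N 𝓕 T hTinf hT0 hS
  refine ⟨K₀, k, ?_, by rw [hK₀dim]; exact hprice⟩
  rw [ledger_top_iff_windowCone]
  intro v hv x p hp a b
  rw [totalDegree_le_iff_coeff]
  intro e he
  rw [← eval_Gp d F x p e a b 0 v]
  exact hK₀ v hv _ ⟨x, p, e, a, b, hp, he, rfl⟩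

end Summit.ValiantsHypothesis.ValiantsHypothesis.Theorems.GrenetZeon.InitialForm.LedgerTorus


end
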